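import Summits.ResolutionOfSingularities.KangarooAtlas.MizutaniLemma29Cases
import HarnessLib

/-!
# Mizutani's Lemma 2.9 — the leading-term count with a prescribed leading index; case `D = αD^{(2,0)} + βD^{(1,1)}`, `β ≠ 0`

Cell topic `Summits/ResolutionOfSingularities/KangarooAtlas` (pub-rosobs); namespace
`Summit.ResolutionOfSingularities.KangarooAtlas.Mizutani`.  Part of the Lean transcription of Mizutani 1973 §2
around the in-house note MIZUTANI-PROOF-g59 (AI-written, AI-audited; *AI review is weaker than expert review*; not a
resolution theorem).

Mizutani, Lemma 2.9 (proof, p. 93–94): the left ideal `Diff(K/k^p)·D` contains the `K`-independent operators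
`D^{(S)} ∘ D` whose leading terms `c_{W₀} C(S+W₀,W₀) D^{(S+W₀)}` are distinct; `dim_K {Φ : Φ(ker D) = 0} = p² − dim ker D`.
Encloser-1 g6 ran this count with the leading index `W₀` of largest second coordinate and concluded `dim ker D ≤ 2p`
(`IsRootTower.finrank_ker_le_two_mul`).  Here the same count is exposed with the leading index as a PARAMETER:

* `IsRootTower.count_add_finrank_ker_le` — `(p − W₀(0))(p − W₀(1)) + dim_L ker D ≤ p²` whenever
  `D = Σ_{W ∈ F} c_W D^{(W)}` over degree-2 indices, `W₀ ∈ F`, `c_{W₀} ≠ 0`, and `W₀` has the largest second coordinate;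
* **`IsRootTower.finrank_ker_le_of_sq_eq_zero_of_ne_zero`** — case (ii) of Lemma 2.9 (2): if `D(a₁²) = 0` and
  `D(a₀a₁) ≠ 0` (`D = αD^{(2,0)} + βD^{(1,1)}`, `β ≠ 0`, leading index `(1,1)`) then `dim_L ker D ≤ 2p − 1 < 2p`
  (Mizutani p. 93: «If `a' = c' = 0`, then `dim T = 2p − 1`»).

References: [Mizutani1973HironakaGroupSchemes] Lemma 2.9, p. 92–94.
-/

open MvPolynomial Literature.AlgebraicGeometry.Resolution
open Literature.RingTheory.MvPolynomial.Ruppert (degree_fin_two)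

namespace Summit.ResolutionOfSingularities.KangarooAtlas.Mizutani

universe u

section Count

variable {L K : Type u} [Field L] [Field K] [Algebra L K] {p : ℕ} [hp : Fact p.Prime] [CharP K p]
  {x : Fin 2 → L} {a : Fin 2 → K}

/-- **The leading-term count with a prescribed leading index.**  If `D = Σ_{W ∈ F} c_W D^{(W)}` with all `W ∈ F` of
degree `2`, `W₀ ∈ F`, `c_{W₀} ≠ 0` and `W(1) ≤ W₀(1)` on `F`, then the `(p − W₀(0))(p − W₀(1))` operators `D^{(S)} ∘ D`,
`S + W₀` in the box, are `K`-independent and kill `ker D`, whence `(p − W₀(0))(p − W₀(1)) + dim_L ker D ≤ p²`.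
[cite: Mizutani1973HironakaGroupSchemes, Lemma 2.9 (proof, p. 93–94: «dim_K I ≥ p(p − 2)», «p² − n = dim_K Hom(K/T, K) ≥ dim_K I»)] -/
theorem IsRootTower.count_add_finrank_ker_le (h : IsRootTower L K (p ^ 1) x a) (D : K →ₗ[L] K)
    (F : Finset (Fin 2 → Fin (p ^ 1))) (hF : ∀ W ∈ F, (finsuppOf W).degree = 2) (c : (Fin 2 → Fin (p ^ 1)) → K)
    (hDsum : D = ∑ W ∈ F, c W • h.hsD (finsuppOf W)) (W₀ : Fin 2 → Fin (p ^ 1)) (hW₀ : W₀ ∈ F) (hc₀ : c W₀ ≠ 0)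
    (hmax : ∀ W ∈ F, (finsuppOf W) 1 ≤ (finsuppOf W₀) 1) :
    (p - (finsuppOf W₀) 0) * (p - (finsuppOf W₀) 1) + Module.finrank L (LinearMap.ker D) ≤ p ^ 2 := by
  classical
  haveI := h.finiteDimensional
  set T₀ : Fin 2 →₀ ℕ := finsuppOf W₀ with hT₀
  have hT₀box : InBox (p ^ 1) T₀ := inBox_finsuppOf W₀
  -- the family `Φ_{uv} = D^{(S_{uv})} ∘ D`, `S_{uv} = (u, v)` with `S + T₀` in the box
  have hu : ∀ u : Fin (p ^ 1 - T₀ 0), (u : ℕ) + T₀ 0 < p ^ 1 := fun u => by have := u.2; omega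
  have hv : ∀ v : Fin (p ^ 1 - T₀ 1), (v : ℕ) + T₀ 1 < p ^ 1 := fun v => by have := v.2; omega
  let Sv : Fin (p ^ 1 - T₀ 0) × Fin (p ^ 1 - T₀ 1) → Fin 2 →₀ ℕ := fun uv =>
    Finsupp.single 0 (uv.1 : ℕ) + Finsupp.single 1 (uv.2 : ℕ)
  have hSv0 : ∀ uv, Sv uv 0 = uv.1 := fun uv => by
    simp only [Sv, Finsupp.add_apply, Finsupp.single_eq_same, Finsupp.single_eq_of_ne (show (0 : Fin 2) ≠ 1 by decide),
      add_zero]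
  have hSv1 : ∀ uv, Sv uv 1 = uv.2 := fun uv => by
    simp only [Sv, Finsupp.add_apply, Finsupp.single_eq_same, Finsupp.single_eq_of_ne (show (1 : Fin 2) ≠ 0 by decide),
      zero_add]
  have hSvbox : ∀ uv, InBox (p ^ 1) (Sv uv) := fun uv =>
    inBox_fin_two (by rw [hSv0]; have := hu uv.1; omega) (by rw [hSv1]; have := hv uv.2; omega)
  have hSTbox : ∀ uv, InBox (p ^ 1) (Sv uv + T₀) := fun uv =>
    inBox_fin_two (by rw [Finsupp.add_apply, hSv0]; exact hu uv.1) (by rw [Finsupp.add_apply, hSv1]; exact hv uv.2)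
  let Φ : Fin (p ^ 1 - T₀ 0) × Fin (p ^ 1 - T₀ 1) → (K →ₗ[L] K) := fun uv => h.hsD (Sv uv) ∘ₗ D
  -- linear independence by leading terms
  have hΦind : LinearIndependent K Φ := by
    refine linearIndependent_of_leading h.hsDBasis (fun W => key p (finsuppOf W)) key_finsuppOf_injective Φ
      (fun uv => toTuple (Sv uv + T₀) (hSTbox uv)) ?_ (fun uv => c W₀ * (mchoose (Sv uv + T₀) T₀ : K)) ?_ ?_
    · intro uv uv' heq
      have h' : Sv uv + T₀ = Sv uv' + T₀ := by
        have := congrArg finsuppOf heq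
        rwa [finsuppOf_toTuple, finsuppOf_toTuple] at this
      have h'' : Sv uv = Sv uv' := add_right_cancel h'
      have e0 := congrArg (fun M : Fin 2 →₀ ℕ => M 0) h''
      have e1 := congrArg (fun M : Fin 2 →₀ ℕ => M 1) h''
      simp only [hSv0, hSv1] at e0 e1
      exact Prod.ext (Fin.ext e0) (Fin.ext e1)
    · intro uv
      exact mul_ne_zero hc₀ (mchoose_cast_ne_zero (hSTbox uv) le_add_self)
    · intro uv
      show h.hsD (Sv uv) ∘ₗ D - (c W₀ * (mchoose (Sv uv + T₀) T₀ : K)) • h.hsDBasis (toTuple (Sv uv + T₀) (hSTbox uv)) ∈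
        Submodule.span K (h.hsDBasis '' {W | key p (finsuppOf W) < key p (finsuppOf (toTuple (Sv uv + T₀) (hSTbox uv)))})
      rw [h.hsDBasis_apply, finsuppOf_toTuple]
      refine lowSpan_le_span_image h (key p (Sv uv + T₀)) ?_
      have := h.hsD_comp_sub_mem_lowSpan F hF c W₀ hW₀ hmax (hSvbox uv)
      rwa [← hDsum] at this
  -- the family kills `ker D`
  have hΦann : Submodule.span K (Set.range Φ) ≤ annihilator L K (LinearMap.ker D) := by
    refine Submodule.span_le.mpr ?_
    rintro _ ⟨uv, rfl⟩ y hy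
    show h.hsD (Sv uv) (D y) = 0
    rw [LinearMap.mem_ker.mp hy, map_zero]
  -- count
  have hcard := Submodule.finrank_mono hΦann
  rw [finrank_span_eq_card hΦind, Fintype.card_prod, Fintype.card_fin, Fintype.card_fin] at hcard
  have hann := finrank_annihilator_add (L := L) (K := K) (LinearMap.ker D)
  rw [h.finrank_end] at hann
  rw [pow_one] at hcard hann
  omega

/-- **Case (ii) of Lemma 2.9 (2), ⇒: `D(a₁²) = 0`, `D(a₀a₁) ≠ 0` ⇒ `dim_L ker D ≤ 2p − 1`** — the leading index is
`(1,1)` and the count gives `(p − 1)² + dim ker D ≤ p²`.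
[cite: Mizutani1973HironakaGroupSchemes, Lemma 2.9 (proof, p. 93: «If a' = c' = 0, then dim T = 2p − 1»)] -/
theorem IsRootTower.finrank_ker_le_of_sq_eq_zero_of_ne_zero (h : IsRootTower L K (p ^ 1) x a) (hp2 : p ≠ 2)
    {D : K →ₗ[L] K} (hD : IsDiffOpLE L 2 D) (h1 : D 1 = 0) (ha : ∀ i, D (a i) = 0) (hγ : D (a 1 ^ 2) = 0)
    (hβ : D (a 0 * a 1) ≠ 0) : Module.finrank L (LinearMap.ker D) ≤ 2 * p - 1 := by
  classical
  have hW20deg : (Finsupp.single 0 2 : Fin 2 →₀ ℕ).degree = 2 := Finsupp.degree_single _ _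
  have hW11deg : (Finsupp.single 0 1 + Finsupp.single 1 1 : Fin 2 →₀ ℕ).degree = 2 := degree_single_add_single
  set W20 : Fin 2 → Fin (p ^ 1) := toTuple (Finsupp.single 0 2) (inBox_of_degree_le_two hp2 hW20deg.le) with hW20
  set W11 : Fin 2 → Fin (p ^ 1) :=
    toTuple (Finsupp.single 0 1 + Finsupp.single 1 1) (inBox_of_degree_le_two hp2 hW11deg.le) with hW11
  have hf20 : finsuppOf W20 = Finsupp.single 0 2 := finsuppOf_toTuple _ _
  have hf11 : finsuppOf W11 = Finsupp.single 0 1 + Finsupp.single 1 1 := finsuppOf_toTuple _ _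
  have hne : W20 ≠ W11 := by
    intro heq
    have := congrArg (fun W => finsuppOf W 1) heq
    rw [hf20, hf11] at this
    simp at this
  set F : Finset (Fin 2 → Fin (p ^ 1)) := {W20, W11} with hFdef
  set c : (Fin 2 → Fin (p ^ 1)) → K := fun W => if W = W11 then D (a 0 * a 1) else D (a 0 ^ 2) with hc
  have hF : ∀ W ∈ F, (finsuppOf W).degree = 2 := by
    intro W hW
    rw [hFdef, Finset.mem_insert, Finset.mem_singleton] at hW
    rcases hW with rfl | rfl
    · rw [hf20, hW20deg]
    · rw [hf11, hW11deg]
  have hDsum : D = ∑ W ∈ F, c W • h.hsD (finsuppOf W) := by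
    rw [hFdef, Finset.sum_insert (by rwa [Finset.mem_singleton]), Finset.sum_singleton, hf20, hf11]
    simp only [hc, if_neg hne, if_pos rfl]
    conv_lhs => rw [h.eq_three_of_isDiffOpLE_two hp2 hD h1 ha, hγ, zero_smul, add_zero]
  have hcount := h.count_add_finrank_ker_le D F hF c hDsum W11
    (by rw [hFdef]; exact Finset.mem_insert_of_mem (Finset.mem_singleton_self _))
    (by simp only [hc, if_pos rfl]; exact hβ)
    (by
      intro W hW
      rw [hFdef, Finset.mem_insert, Finset.mem_singleton] at hW
      rcases hW with rfl | rfl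
      · rw [hf20, hf11]; simp
      · exact le_rfl)
  rw [hf11] at hcount
  simp only [Finsupp.add_apply, Finsupp.single_eq_same, Finsupp.single_eq_of_ne (show (0 : Fin 2) ≠ 1 by decide),
    Finsupp.single_eq_of_ne (show (1 : Fin 2) ≠ 0 by decide), add_zero, zero_add] at hcount
  have hp2' := hp.out.two_le
  have hsq : (p - 1) * (p - 1) + (2 * p - 1) = p ^ 2 := by
    obtain ⟨q, rfl⟩ : ∃ q, p = q + 1 := ⟨p - 1, by omega⟩
    rw [Nat.add_sub_cancel, sq]
    ring_nf
    omega
  omega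

end Count

end Summit.ResolutionOfSingularities.KangarooAtlas.Mizutani
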